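/-
Copyright (c) 2026 the pub-hodgecm-mathlib formalisation cell (harness21).  Prover seat hodgecm-mathlib-K2E3-p03 (g9): Track B «K2-LIT»,
#184♮ = hLiu418 = stmt-HodgeConjecture-24832; socket #41, KIND W, brick (KW-fin-supp) — LEAD F0P6-plan (g15) BATCH #181 (1), KW desk F0P2-p08 (g3).
THEOREMS ONLY (no `def`, no `instance`, no notation, no named-fact hypothesis, no `sorry`).
-/
import Summits.HodgeConjecture.HodgeConjecture.Theorems.K2LiuKindWFiniteLetterDefs         -- ★ p863154 (iii-fin): `kindWFfin`, `kindWLocalBall`, `measurableSet_kindWLocalBall`, `kindWLocalBall_antitone`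
import Summits.HodgeConjecture.HodgeConjecture.Theorems.K2LiuSiegelUnipotentCharacters     -- ★ `unipDeltaChar_mul`
import Summits.HodgeConjecture.HodgeConjecture.Theorems.K2LiuUnipDeltaLocBridge             -- ★ `unipDeltaLoc_eq_unipDeltaLocal` (+ ★ D10 `unipDeltaLocal`, `mul_comm_of_mem_unipDeltaLocal`)
import HarnessLib

/-!
# Crux `HLiu418`, socket #41, KIND W — `K2LiuKindWFiniteSupportLetterOfLevel` ((KW-fin-supp)): THE PER-PLACE SUPPORT LETTER `hsuppLoc` OF ★ p863047 AT THE CONTINUED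
# FINITE LETTER `Ffin := kindWFfin` OF RECORD — shell-zero on `N_Δ(L⁺_v)`, hypothesis-first in the LEVEL letter and the DUAL-LATTICE letter

Cell `hodgecm-mathlib`, crux item hLiu418 = `stmt-HodgeConjecture-24832` (helper lane `--supports … --as helper`, count-neutral), route of record `HCCMUnconditional`; squad K2 ∕
K2Liu, road `K2_Liu`, socket #41 `sig_K2LiuSiegelEisensteinContinuation`, KIND W; LEAD F0P6-plan (g15) BATCH #181 (1), KW desk F0P2-p08 (g3), box K2Liu-audit1 (g3).
THE POINT.  ★ p863047 `K2LiuKindWFinitePartLettersOfRecord.hfsupp_of_levelLetters` turns a per-place SUPPORT letter `hsuppLoc` in LEVEL currency («`Ffin v j i s x ≠ 0` ⟹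
`|mat i_{ab}|_w ≤ q_w^{lev x w + c w}` at every `w ∣ v`») into the KW head's `hfsupp`; ★ p863154 `K2LiuKindWFiniteLetterDefs` DEFINES the continued finite letter of record
`kindWFfin T₀ νv π FvT j S h v s = lim_k ∫_{ball(−k)} conj ψ_S(ι_v y) · FvT j S h v s (W_v·y·h_v) dν_v(y)` on `N_Δ(L⁺_v)` (the local factor `FvT` BY VALUE).  THIS FILE pays `hsuppLoc`
at `Ffin := kindWFfin` by the SHELL-ZERO mechanism, PROVED here on `N_Δ(L⁺_v)`, from two arithmetic letters kept BY VALUE: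
* §1 **`setIntegral_eq_zero_of_mul_left_translate`** — abstract shell-zero: on a group with a left-invariant measure, `∫_B χ·F = 0` as soon as `B` is `u₀`-stable, `F` is
  `u₀`-invariant and `χ(u₀ y) = ζ χ(y)` with `ζ ≠ 1` (Mathlib `integral_mul_left_eq_self` on the indicator: `I = ζ I`).
* §2 `N_Δ(L⁺_v)` bookkeeping — `exists_adapt_matA_coe_eq` (every element is `n(t)` in the adapted frame, ★ D10 `unipDeltaLocal` through ★ `unipDeltaLoc_eq_unipDeltaLocal`),
  **`blkB_matA_coe_mul`** ∕ `blkB_matA_one` ∕ `blkB_matA_coe_inv` (the chart coordinate `B = blkB ∘ matA` is ADDITIVE, ★ `fromBlocks_unip_mul`), **`mul_mem_kindWLocalBall_iff`**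
  (the ★ `kindWLocalBall`s are stable under translation by their elements — ultrametric inequality), `unipDeltaChar_locToAdelic_coe_mul` (`ψ_S ∘ ι_v` is multiplicative, ★
  `unipDeltaChar_mul`), `unipDeltaLoc_mul_comm` (`N_Δ(L⁺_v)` is abelian, ★ `mul_comm_of_mem_unipDeltaLocal` — so LEFT Haar invariance does the RIGHT-translate trick).
* §3 **`setIntegral_kindWLocalBall_eq_zero_of_invariant`** — for `u₀ ∈ ball(a₀)` with `ψ_S(ι_v u₀) ≠ 1` and a weight `G` with `G(y u₀) = G(y)`:
  `∫_{ball a} conj ψ_S(ι_v y) · G y dν = 0` for every `a ≤ a₀` (`ν` left-invariant).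
* §4 **`kindWFfin_eq_zero_of_invariant`** — hence `kindWFfin … j S h v s = 0` whenever some `u₀ ∈ ball(a₀)` moves `ψ_S` but fixes the local factor
  (`FvT j S h v s (W_v·ι(y u₀)·h_v) = FvT j S h v s (W_v·ι(y)·h_v)`, the LEVEL letter at `u₀`: `h_v⁻¹ u₀ h_v` lies in the level group of the section): the ball integrals vanish for
  `−k ≤ a₀`, and the `limUnder` of an eventually-zero sequence is `0`; contrapositive **`unipDeltaChar_eq_one_of_kindWFfin_ne_zero`**: `Ffin ≠ 0 ⟹ ψ_S ≡ 1` on the invariance ball.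
* §5 **`hsuppLoc_of_level`** — ★ p863047's `hsuppLoc` BYTES (:204–:205) VERBATIM at `ι := Skew`, `X := H(𝔸)`, `κT := Fin m`, `mat S := ↑S`, `Tfin S h := kindWFinset T₀ ↑S h`,
  `Ffin v j S s h := kindWFfin T₀ νv π FvT j S h v s`, from BY-VALUE letters `lev`, `c` (as dealt), a ball exponent `a₀ : H(𝔸) → 𝔭 ↦ ℤ`, the LEVEL letter `hFinv` (payer: the
  reading of `FvT` ((KW-fac-read)) + the uniform open level of the standard family ★ (ρ7) `K2LiuStandardFamilyUniformLevel` + level-vs-height ★ (c1)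
  `K2LiuLocalHeightLevelConjugation`) and the DUAL-LATTICE letter `hdual` «`ψ_S(ι_v u₀) = 1` on `ball(a₀ h v)` ⟹ `|S_{ab}|_w ≤ q_w^{lev h w + c w}`» (payer: character duality —
  at `n = 2` ★ (ρ3) `K2LiuKindOneLineCharacterBoundTwo.valued_entry_le_exp_of_forall_test` with ★ (b2′) `K2LiuKindOneLineCharacterReading`; generic `n` open «(KW-fin-dual)»).
  The hypothesis `0 < re s` of the bytes is carried unused; `(νv v).IsMulLeftInvariant` holds for the ★ p862988 carriers (`IsHaarMeasure`).
[KudlaRallis1994, §2], [Shimura1997, §18.3–18.4 (Prop. 18.14)], [Casselman1980, §3], [HarrisKudlaSweet1996, §1 (1.11)–(1.12)].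
HONEST LABEL.  Count-neutral helper, closes no socket: `HC_CM` is proved only modulo the 7 printed citations (2 remaining named inputs: hLiu418 =
`stmt-HodgeConjecture-24832`, h413 = `stmt-HodgeConjecture-24833`) until rung 0 closes.  NOT HERE: the LEVEL letter's payer (reading of `FvT` + (ρ7) + (c1)) and the
DUAL-LATTICE letter's payer (character duality at the place), both named above.

## References
* [KudlaRallis1994] S. Kudla, S. Rallis, *A regularized Siegel–Weil formula: the first term identity*, Ann. of Math. 140 (1994), §2 (support of local Whittaker functionals).
* [Shimura1997] G. Shimura, *Euler products and Eisenstein series*, CBMS 93 (1997), §18.3–18.4, Prop. 18.14 (Fourier coefficients supported in a dual lattice).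
* [Casselman1980] W. Casselman, *The unramified principal series of p-adic groups I*, Compositio Math. 40 (1980), §3 (the translate ∕ averaging trick).
* [HarrisKudlaSweet1996] M. Harris, S. Kudla, W. J. Sweet, *Theta dichotomy for unitary groups*, J. AMS 9 (1996), §1 (1.11)–(1.12) (`n(t)n(t′) = n(t+t′)`).
-/

set_option autoImplicit false
-- the mandated namespace repeats the single-problem summit's segment (`HodgeConjecture.HodgeConjecture`)
set_option linter.dupNamespace false

noncomputable section

open scoped Matrix RestrictedProduct ENNReal NNReal Topology ComplexConjugate BigOperators
-- the `if v ∈ kindWFinset …` of the letter of record is classical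
open scoped Classical
open NumberField IsDedekindDomain MeasureTheory Measure Filter Set

namespace Summit.HodgeConjecture.HodgeConjecture.Cruxes.HLiu418.K2LiuKindWFiniteSupportLetterOfLevel

open Literature.NumberTheory.Automorphic Literature.NumberTheory.GaloisRepresentations Literature.NumberTheory.LFunctions
open Literature.NumberTheory.GelbartRogawski1991 Literature.NumberTheory.GelbartRogawski1991.GRConstruction
open Literature.NumberTheory.GelbartRogawski1991.AdaptedBlocks
open Literature.NumberTheory.GelbartRogawski1991.UnitaryDualPair Literature.NumberTheory.GelbartRogawski1991.UnitaryDualPair.LocalSplitting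
open Literature.NumberTheory.K2Lit.SiegelDoubled Literature.NumberTheory.K2Lit.LocalSiegelDoubled
open Literature.NumberTheory.K2Lit.PlaceSplitting
open Literature.MeasureTheory.RestrictedProduct
open Summit.HodgeConjecture.HodgeConjecture.Cruxes.HLiu418.K2LiuSiegelUnipotentLocalDefs
open Summit.HodgeConjecture.HodgeConjecture.Cruxes.HLiu418.K2LiuSiegelUnipotentSplitDefs
open Summit.HodgeConjecture.HodgeConjecture.Cruxes.HLiu418.K2LiuSiegelUnipotentSplitAtDefs
open Summit.HodgeConjecture.HodgeConjecture.Cruxes.HLiu418.K2LiuSiegelUnipotentFourierDefs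
open Summit.HodgeConjecture.HodgeConjecture.Cruxes.HLiu418.K2LiuSiegelUnipotentCharacters (unipDeltaChar_mul)
open Summit.HodgeConjecture.HodgeConjecture.Cruxes.HLiu418.K2LiuSiegelEisensteinKindWLetters
open Summit.HodgeConjecture.HodgeConjecture.Cruxes.HLiu418.K2LiuKindWFiniteLetterDefs
open Summit.HodgeConjecture.HodgeConjecture.Cruxes.HLiu418.K2LiuUnipDeltaLocBridge (unipDeltaLoc_eq_unipDeltaLocal)

/-! ## §1 Shell-zero on a group: a character integral over a translation-stable set vanishes when the weight is invariant and the character moves -/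

/-- **SHELL-ZERO (abstract form).**  `G` a group with a left-invariant measure `μ`, `B ⊆ G` measurable and stable under left translation by `u₀` (`u₀·y ∈ B ↔ y ∈ B`),
`χ` moved by `u₀` through a scalar `ζ ≠ 1` (`χ(u₀ y) = ζ·χ(y)`), `F` invariant (`F(u₀ y) = F y`): then `∫_B χ·F dμ = 0` — substituting `y ↦ u₀ y` (Mathlib
`integral_mul_left_eq_self` on the indicator of `B`) gives `I = ζ·I`. [cite: Casselman1980, §3] [cite: KudlaRallis1994, §2] -/
theorem setIntegral_eq_zero_of_mul_left_translate {G : Type*} [Group G] [MeasurableSpace G] [MeasurableMul G] (μ : Measure G) [μ.IsMulLeftInvariant]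
    {B : Set G} (hBm : MeasurableSet B) (u₀ : G) (hBu : ∀ y, u₀ * y ∈ B ↔ y ∈ B) {χ F : G → ℂ} {ζ : ℂ} (hχ : ∀ y, χ (u₀ * y) = ζ * χ y)
    (hF : ∀ y, F (u₀ * y) = F y) (hζ : ζ ≠ 1) :
    ∫ y in B, χ y * F y ∂μ = 0 := by
  have hind : ∫ y in B, χ y * F y ∂μ = ∫ y, B.indicator (fun y => χ y * F y) y ∂μ := (integral_indicator hBm).symm
  have hshift : ∫ y, B.indicator (fun y => χ y * F y) (u₀ * y) ∂μ = ∫ y, B.indicator (fun y => χ y * F y) y ∂μ :=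
    integral_mul_left_eq_self _ u₀
  have hpt : (fun y => B.indicator (fun y => χ y * F y) (u₀ * y)) = fun y => ζ * B.indicator (fun y => χ y * F y) y := by
    funext y
    by_cases hy : y ∈ B
    · rw [Set.indicator_of_mem ((hBu y).2 hy), Set.indicator_of_mem hy, hχ, hF y, mul_assoc]
    · rw [Set.indicator_of_notMem (fun h => hy ((hBu y).1 h)), Set.indicator_of_notMem hy, mul_zero]
  have hζI : ζ * ∫ y in B, χ y * F y ∂μ = ∫ y in B, χ y * F y ∂μ := by
    rw [hind, ← integral_const_mul, ← hpt, hshift]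
  have h0 : (ζ - 1) * ∫ y in B, χ y * F y ∂μ = 0 := by rw [sub_mul, one_mul, hζI, sub_self]
  rcases mul_eq_zero.1 h0 with h | h
  · exact absurd (sub_eq_zero.1 h) hζ
  · exact h

/-! ## §2 The unipotent radical `N_Δ(L⁺_v)`: the chart coordinate is additive, the balls are translation-stable, the character is multiplicative, the group is abelian -/

variable (L : Type) [Field L] [NumberField L] [IsCMField L]
variable {N M n : ℕ} (e : Fin N × Fin M ≃ Fin n)
  (dV : Fin N → L) (hdV : ∀ i, IsCMField.complexConj L (dV i) = dV i)
  (dW : Fin M → L) (hdW : ∀ i, IsCMField.complexConj L (dW i) = dW i)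
  (v : HeightOneSpectrum (𝓞 (Fp L)))

/-- an element of `N_Δ(L⁺_v)` is `n(t)` in the adapted frame: `adapt(matA u) = (1 t; 0 1)` (★ D10 `unipDeltaLocal` through ★ `unipDeltaLoc_eq_unipDeltaLocal`).
[cite: HarrisKudlaSweet1996, §1 (1.11)–(1.12)] -/
theorem exists_adapt_matA_coe_eq (y : ↥(unipDeltaLoc L e dV hdV dW hdW v)) :
    ∃ t : Matrix (Fin n) (Fin n) (UnitaryGroup.LocalRing L v), adapt (matA (Fp L) L (IsCMField.complexConj L) v n
        (y : UnitaryGroup.localPi L (IsCMField.complexConj L) (n + n) (hermD L e dV hdV dW hdW) v)) = Matrix.fromBlocks 1 t 0 1 := by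
  have hy : (y : UnitaryGroup.localPi L (IsCMField.complexConj L) (n + n) (hermD L e dV hdV dW hdW) v) ∈
      unipDeltaLocal (Fp L) L (IsCMField.complexConj L) v n (JD := hermD L e dV hdV dW hdW) := by
    rw [← unipDeltaLoc_eq_unipDeltaLocal L e dV hdV dW hdW v]; exact y.2
  obtain ⟨t, ht⟩ := hy
  exact ⟨t, ht⟩

omit [NumberField L] [IsCMField L] in
/-- reading the `B`-block off the adapted frame: `adapt M = (1 t; 0 1) ⇒ B(M) = t` (★ `adapt_eq`). [cite: HarrisKudlaSweet1996, §1 (1.11)] -/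
theorem blkB_eq_of_adapt_eq {R : Type*} [CommRing R] [Invertible (2 : R)] {M : Matrix (Fin n ⊕ Fin n) (Fin n ⊕ Fin n) R} {t : Matrix (Fin n) (Fin n) R}
    (h : adapt M = Matrix.fromBlocks 1 t 0 1) : blkB M = t := by
  rw [adapt_eq] at h
  exact (Matrix.fromBlocks_inj.1 h).2.1

/-- **the chart coordinate `B(u) = blkB (matA u)` is ADDITIVE on `N_Δ(L⁺_v)`**: `B(y u) = B(y) + B(u)` (`n(t) n(t′) = n(t + t′)`, ★ `fromBlocks_unip_mul`).
[cite: HarrisKudlaSweet1996, §1 (1.11)–(1.12)] -/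
theorem blkB_matA_coe_mul (y u : ↥(unipDeltaLoc L e dV hdV dW hdW v)) :
    blkB (matA (Fp L) L (IsCMField.complexConj L) v n
        ((y * u : ↥(unipDeltaLoc L e dV hdV dW hdW v)) : UnitaryGroup.localPi L (IsCMField.complexConj L) (n + n) (hermD L e dV hdV dW hdW) v)) =
      blkB (matA (Fp L) L (IsCMField.complexConj L) v n
          (y : UnitaryGroup.localPi L (IsCMField.complexConj L) (n + n) (hermD L e dV hdV dW hdW) v)) +
        blkB (matA (Fp L) L (IsCMField.complexConj L) v n
          (u : UnitaryGroup.localPi L (IsCMField.complexConj L) (n + n) (hermD L e dV hdV dW hdW) v)) := by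
  obtain ⟨t, ht⟩ := exists_adapt_matA_coe_eq L e dV hdV dW hdW v y
  obtain ⟨t', ht'⟩ := exists_adapt_matA_coe_eq L e dV hdV dW hdW v u
  have hyu : adapt (matA (Fp L) L (IsCMField.complexConj L) v n
      ((y * u : ↥(unipDeltaLoc L e dV hdV dW hdW v)) : UnitaryGroup.localPi L (IsCMField.complexConj L) (n + n) (hermD L e dV hdV dW hdW) v)) =
        Matrix.fromBlocks 1 (t' + t) 0 1 := by
    rw [Subgroup.coe_mul, ← matA_mul, adapt_mul, ht, ht', fromBlocks_unip_mul]
  rw [blkB_eq_of_adapt_eq ht, blkB_eq_of_adapt_eq ht', blkB_eq_of_adapt_eq hyu, add_comm]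

/-- `B(1) = 0`. [cite: HarrisKudlaSweet1996, §1 (1.11)–(1.12)] -/
theorem blkB_matA_one :
    blkB (matA (Fp L) L (IsCMField.complexConj L) v n
        (1 : UnitaryGroup.localPi L (IsCMField.complexConj L) (n + n) (hermD L e dV hdV dW hdW) v)) = 0 := by
  have h := blkB_matA_coe_mul L e dV hdV dW hdW v (1 : ↥(unipDeltaLoc L e dV hdV dW hdW v)) 1
  rw [mul_one, Subgroup.coe_one] at h
  -- `x = x + x` forces `x = 0`
  have h' := h.symm
  rwa [add_eq_left] at h'

/-- `B(u⁻¹) = −B(u)` on `N_Δ(L⁺_v)`. [cite: HarrisKudlaSweet1996, §1 (1.11)–(1.12)] -/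
theorem blkB_matA_coe_inv (u : ↥(unipDeltaLoc L e dV hdV dW hdW v)) :
    blkB (matA (Fp L) L (IsCMField.complexConj L) v n
        ((u⁻¹ : ↥(unipDeltaLoc L e dV hdV dW hdW v)) : UnitaryGroup.localPi L (IsCMField.complexConj L) (n + n) (hermD L e dV hdV dW hdW) v)) =
      -blkB (matA (Fp L) L (IsCMField.complexConj L) v n
          (u : UnitaryGroup.localPi L (IsCMField.complexConj L) (n + n) (hermD L e dV hdV dW hdW) v)) := by
  have h := blkB_matA_coe_mul L e dV hdV dW hdW v u⁻¹ u
  rw [inv_mul_cancel, Subgroup.coe_one, blkB_matA_one] at h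
  exact eq_neg_of_add_eq_zero_left h.symm

/-- **the balls are stable under translation by their elements**: for `u₀ ∈ ball a`, `u₀·y ∈ ball a ↔ y ∈ ball a` (ultrametric inequality on `B(u₀ y) = B(u₀) + B(y)`).
[cite: KudlaRallis1994, §2] [cite: Shimura1997, §18.3] -/
theorem mul_mem_kindWLocalBall_iff (π : v.adicCompletion (Fp L)) (a : ℤ) {u₀ : ↥(unipDeltaLoc L e dV hdV dW hdW v)}
    (hu₀ : u₀ ∈ kindWLocalBall L e dV hdV dW hdW v π a) (y : ↥(unipDeltaLoc L e dV hdV dW hdW v)) :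
    u₀ * y ∈ kindWLocalBall L e dV hdV dW hdW v π a ↔ y ∈ kindWLocalBall L e dV hdV dW hdW v π a := by
  rw [mem_kindWLocalBall_iff] at hu₀
  -- one direction for every element of the ball, applied to `u₀` and to `u₀⁻¹`
  have key : ∀ (u z : ↥(unipDeltaLoc L e dV hdV dW hdW v)),
      (∀ (i j : Fin n) (w : UnitaryGroup.PlacesOver L v), Valued.v (blkB (matA (Fp L) L (IsCMField.complexConj L) v n
        (u : UnitaryGroup.localPi L (IsCMField.complexConj L) (n + n) (hermD L e dV hdV dW hdW) v)) i j w) ≤ Valued.v (UnitaryGroup.toPlace v w π) ^ a) →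
      z ∈ kindWLocalBall L e dV hdV dW hdW v π a → u * z ∈ kindWLocalBall L e dV hdV dW hdW v π a := by
    intro u z hu hz
    rw [mem_kindWLocalBall_iff] at hz ⊢
    intro i j w
    rw [blkB_matA_coe_mul, Matrix.add_apply, Pi.add_apply]
    exact (Valuation.map_add _ _ _).trans (max_le (hu i j w) (hz i j w))
  refine ⟨fun h => ?_, key u₀ y hu₀⟩
  have hinv : ∀ (i j : Fin n) (w : UnitaryGroup.PlacesOver L v), Valued.v (blkB (matA (Fp L) L (IsCMField.complexConj L) v n
      ((u₀⁻¹ : ↥(unipDeltaLoc L e dV hdV dW hdW v)) : UnitaryGroup.localPi L (IsCMField.complexConj L) (n + n) (hermD L e dV hdV dW hdW) v)) i j w) ≤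
        Valued.v (UnitaryGroup.toPlace v w π) ^ a := fun i j w => by
    rw [blkB_matA_coe_inv, Matrix.neg_apply, Pi.neg_apply, Valuation.map_neg]
    exact hu₀ i j w
  have h' := key u₀⁻¹ (u₀ * y) hinv h
  rwa [inv_mul_cancel_left] at h'

/-- **`ψ_S ∘ ι_v` is multiplicative on `N_Δ(L⁺_v)`** (★ `unipDeltaChar_mul`, `ι_v` a homomorphism into `N_Δ(𝔸)`). [cite: Shimura1997, §18.1] -/
theorem unipDeltaChar_locToAdelic_coe_mul (S : Matrix (Fin n) (Fin n) L) (u y : ↥(unipDeltaLoc L e dV hdV dW hdW v)) :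
    unipDeltaChar L e dV hdV dW hdW S (locToAdelic L e dV hdV dW hdW v
        ((u * y : ↥(unipDeltaLoc L e dV hdV dW hdW v)) : UnitaryGroup.localPi L (IsCMField.complexConj L) (n + n) (hermD L e dV hdV dW hdW) v)) =
      unipDeltaChar L e dV hdV dW hdW S (locToAdelic L e dV hdV dW hdW v
          (u : UnitaryGroup.localPi L (IsCMField.complexConj L) (n + n) (hermD L e dV hdV dW hdW) v)) *
        unipDeltaChar L e dV hdV dW hdW S (locToAdelic L e dV hdV dW hdW v
          (y : UnitaryGroup.localPi L (IsCMField.complexConj L) (n + n) (hermD L e dV hdV dW hdW) v)) := by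
  rw [Subgroup.coe_mul, map_mul]
  exact unipDeltaChar_mul L e dV hdV dW hdW S (locToAdelic_mem_unipDelta L e dV hdV dW hdW u.2) (locToAdelic_mem_unipDelta L e dV hdV dW hdW y.2)

/-- **`N_Δ(L⁺_v)` is abelian** (★ `mul_comm_of_mem_unipDeltaLocal` through ★ `unipDeltaLoc_eq_unipDeltaLocal`). [cite: HarrisKudlaSweet1996, §1 (1.11)] -/
theorem unipDeltaLoc_mul_comm (u y : ↥(unipDeltaLoc L e dV hdV dW hdW v)) : u * y = y * u := by
  have hu : (u : UnitaryGroup.localPi L (IsCMField.complexConj L) (n + n) (hermD L e dV hdV dW hdW) v) ∈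
      unipDeltaLocal (Fp L) L (IsCMField.complexConj L) v n (JD := hermD L e dV hdV dW hdW) := by
    rw [← unipDeltaLoc_eq_unipDeltaLocal L e dV hdV dW hdW v]; exact u.2
  have hy : (y : UnitaryGroup.localPi L (IsCMField.complexConj L) (n + n) (hermD L e dV hdV dW hdW) v) ∈
      unipDeltaLocal (Fp L) L (IsCMField.complexConj L) v n (JD := hermD L e dV hdV dW hdW) := by
    rw [← unipDeltaLoc_eq_unipDeltaLocal L e dV hdV dW hdW v]; exact y.2
  exact Subtype.ext (mul_comm_of_mem_unipDeltaLocal (Fp L) L (IsCMField.complexConj L) v n hu hy)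

/-! ## §3 Shell-zero on `N_Δ(L⁺_v)`: the ball integral of `conj ψ_S(ι_v y) · G(y)` vanishes when `G` is invariant under an element of the ball moving `ψ_S` -/

section Place

variable [∀ v : HeightOneSpectrum (𝓞 (Fp L)), MeasurableSpace ↥(unipDeltaLoc L e dV hdV dW hdW v)]
  [∀ v : HeightOneSpectrum (𝓞 (Fp L)), BorelSpace ↥(unipDeltaLoc L e dV hdV dW hdW v)]

/-- **SHELL-ZERO ON `N_Δ(L⁺_v)`.**  For a left-invariant measure `ν` on `N_Δ(L⁺_v)`, a uniformiser `π`, an index `S`, an element `u₀` of the ball of exponent `a₀` at which the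
character `ψ_S ∘ ι_v` is NOT `1`, and a weight `G : N_Δ(L⁺_v) → ℂ` invariant under RIGHT translation by `u₀`: the integral of `conj ψ_S(ι_v y) · G(y)` over every ball of
exponent `a ≤ a₀` VANISHES (§1 with `χ := conj ψ_S ∘ ι_v`, `ζ := conj ψ_S(ι_v u₀) ≠ 1`; the ball is `u₀`-stable by §2, `N_Δ` is abelian so left-invariance suffices).
[cite: Casselman1980, §3] [cite: KudlaRallis1994, §2] [cite: Shimura1997, §18.3–18.4] -/
theorem setIntegral_kindWLocalBall_eq_zero_of_invariant (ν : Measure ↥(unipDeltaLoc L e dV hdV dW hdW v)) [ν.IsMulLeftInvariant]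
    {π : v.adicCompletion (Fp L)} (hπ : Valued.v π = WithZero.exp (-1 : ℤ)) (S : Matrix (Fin n) (Fin n) L) {a₀ a : ℤ} (ha : a ≤ a₀)
    {u₀ : ↥(unipDeltaLoc L e dV hdV dW hdW v)} (hu₀ : u₀ ∈ kindWLocalBall L e dV hdV dW hdW v π a₀)
    (hψ : unipDeltaChar L e dV hdV dW hdW S (locToAdelic L e dV hdV dW hdW v (u₀ : UnitaryGroup.localPi L (IsCMField.complexConj L) (n + n) (hermD L e dV hdV dW hdW) v)) ≠ 1)
    {G : ↥(unipDeltaLoc L e dV hdV dW hdW v) → ℂ} (hG : ∀ y, G (y * u₀) = G y) :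
    ∫ y in kindWLocalBall L e dV hdV dW hdW v π a,
        conj (unipDeltaChar L e dV hdV dW hdW S (locToAdelic L e dV hdV dW hdW v (y : UnitaryGroup.localPi L (IsCMField.complexConj L) (n + n) (hermD L e dV hdV dW hdW) v)) : ℂ) * G y ∂ν = 0 := by
  refine setIntegral_eq_zero_of_mul_left_translate ν (measurableSet_kindWLocalBall L e dV hdV dW hdW v hπ a) u₀
    (fun y => mul_mem_kindWLocalBall_iff L e dV hdV dW hdW v π a (kindWLocalBall_antitone L e dV hdV dW hdW v hπ ha hu₀) y)
    (ζ := conj (unipDeltaChar L e dV hdV dW hdW S (locToAdelic L e dV hdV dW hdW v (u₀ : UnitaryGroup.localPi L (IsCMField.complexConj L) (n + n) (hermD L e dV hdV dW hdW) v)) : ℂ)) (fun y => ?_) (fun y => ?_) ?_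
  · show conj (unipDeltaChar L e dV hdV dW hdW S (locToAdelic L e dV hdV dW hdW v ((u₀ * y : ↥(unipDeltaLoc L e dV hdV dW hdW v)) : UnitaryGroup.localPi L (IsCMField.complexConj L) (n + n) (hermD L e dV hdV dW hdW) v)) : ℂ) = _
    rw [unipDeltaChar_locToAdelic_coe_mul, Circle.coe_mul, map_mul]
  · show G (u₀ * y) = G y
    rw [unipDeltaLoc_mul_comm L e dV hdV dW hdW v u₀ y]
    exact hG y
  · intro h
    apply hψ
    have h1 : ((unipDeltaChar L e dV hdV dW hdW S (locToAdelic L e dV hdV dW hdW v (u₀ : UnitaryGroup.localPi L (IsCMField.complexConj L) (n + n) (hermD L e dV hdV dW hdW) v)) : Circle) : ℂ) = 1 := by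
      rw [← Complex.conj_conj ((unipDeltaChar L e dV hdV dW hdW S (locToAdelic L e dV hdV dW hdW v (u₀ : UnitaryGroup.localPi L (IsCMField.complexConj L) (n + n) (hermD L e dV hdV dW hdW) v)) : Circle) : ℂ), h, map_one]
    exact Circle.ext h1

/-! ## §4 The continued finite letter of record vanishes (resp. forces `ψ_S ≡ 1` on the invariance ball) -/

set_option maxHeartbeats 400000 in -- MEASURED as ★ p863154 §3 (the dependent `FvT` letter block): default 200 000 fails at `whnf`, 400 000 passes
/-- **`Ffin = 0` OFF THE DUAL CONDITION.**  If some `u₀` in the ball of exponent `a₀` on `N_Δ(L⁺_v)` has `ψ_S(ι_v u₀) ≠ 1` while the local factor is invariant under it —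
`FvT j S h v s (W_v · ι(y u₀) · h_v) = FvT j S h v s (W_v · ι(y) · h_v)` for all `y` (the LEVEL letter: `h_v⁻¹ u₀ h_v` lies in the level group of the section) — then EVERY
ball integral of exponent `−k ≤ a₀` in ★ `kindWFfin` vanishes (§3), so the limit `kindWFfin … j S h v s` is `0`.
[cite: KudlaRallis1994, §2] [cite: Shimura1997, §18.3–18.4] [cite: Casselman1980, §3] -/
theorem kindWFfin_eq_zero_of_invariant (T₀ : Finset (HeightOneSpectrum (𝓞 (Fp L))))
    (νv : ∀ v : HeightOneSpectrum (𝓞 (Fp L)), Measure ↥(unipDeltaLoc L e dV hdV dW hdW v)) (hν : ∀ v, (νv v).IsMulLeftInvariant)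
    {π : ∀ v : HeightOneSpectrum (𝓞 (Fp L)), v.adicCompletion (Fp L)} (hπ : ∀ v, Valued.v (π v) = WithZero.exp (-1 : ℤ)) {m : ℕ}
    (FvT : Fin m → ∀ (S : skewMatrices ((IsCMField.complexConj L : L ≃ₐ[Fp L] L) : L →+* L) ((gramR L e dV hdV dW hdW).map (algebraMap (Fp L) L)))
      (h : HA L e dV hdV dW hdW) (v : (kindWFinset L e dV hdV dW hdW T₀ (S : Matrix (Fin n) (Fin n) L) h)), ℂ → UnitaryGroup.localPi L (IsCMField.complexConj L) (n + n) (hermD L e dV hdV dW hdW) v.1 → ℂ)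
    (j : Fin m) (S : skewMatrices ((IsCMField.complexConj L : L ≃ₐ[Fp L] L) : L →+* L) ((gramR L e dV hdV dW hdW).map (algebraMap (Fp L) L)))
    (h : HA L e dV hdV dW hdW) (v : (kindWFinset L e dV hdV dW hdW T₀ (S : Matrix (Fin n) (Fin n) L) h)) (s : ℂ)
    {a₀ : ℤ} {u₀ : ↥(unipDeltaLoc L e dV hdV dW hdW v.1)} (hu₀ : u₀ ∈ kindWLocalBall L e dV hdV dW hdW v.1 (π v.1) a₀)
    (hψ : unipDeltaChar L e dV hdV dW hdW (S : Matrix (Fin n) (Fin n) L) (locToAdelic L e dV hdV dW hdW v.1 (u₀ : UnitaryGroup.localPi L (IsCMField.complexConj L) (n + n) (hermD L e dV hdV dW hdW) v.1)) ≠ 1)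
    (hFinv : ∀ y : ↥(unipDeltaLoc L e dV hdV dW hdW v.1),
      FvT j S h v s (UnitaryGroup.evalPlace (Fp L) L (IsCMField.complexConj L) (n + n) (hermD L e dV hdV dW hdW) v.1
                (UnitaryGroup.finPart (Fp L) L (IsCMField.complexConj L) (n + n) (hermD L e dV hdV dW hdW) (weylDelta L e dV hdV dW hdW)) *
              ((y * u₀ : ↥(unipDeltaLoc L e dV hdV dW hdW v.1)) : UnitaryGroup.localPi L (IsCMField.complexConj L) (n + n) (hermD L e dV hdV dW hdW) v.1) *
              UnitaryGroup.evalPlace (Fp L) L (IsCMField.complexConj L) (n + n) (hermD L e dV hdV dW hdW) v.1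
                (UnitaryGroup.finPart (Fp L) L (IsCMField.complexConj L) (n + n) (hermD L e dV hdV dW hdW) h)) =
      FvT j S h v s (UnitaryGroup.evalPlace (Fp L) L (IsCMField.complexConj L) (n + n) (hermD L e dV hdV dW hdW) v.1
                (UnitaryGroup.finPart (Fp L) L (IsCMField.complexConj L) (n + n) (hermD L e dV hdV dW hdW) (weylDelta L e dV hdV dW hdW)) *
              ((y : ↥(unipDeltaLoc L e dV hdV dW hdW v.1)) : UnitaryGroup.localPi L (IsCMField.complexConj L) (n + n) (hermD L e dV hdV dW hdW) v.1) *
              UnitaryGroup.evalPlace (Fp L) L (IsCMField.complexConj L) (n + n) (hermD L e dV hdV dW hdW) v.1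
                (UnitaryGroup.finPart (Fp L) L (IsCMField.complexConj L) (n + n) (hermD L e dV hdV dW hdW) h))) :
    kindWFfin L e dV hdV dW hdW T₀ νv π FvT j S h v.1 s = 0 := by
  rw [kindWFfin, dif_pos v.2]
  refine Filter.Tendsto.limUnder_eq (tendsto_const_nhds.congr' ?_)
  filter_upwards [Filter.eventually_ge_atTop (Int.toNat (-a₀))] with k hk
  haveI := hν v.1
  have hk' : -(k : ℤ) ≤ a₀ := by have := Int.toNat_le.1 hk; omega
  exact (setIntegral_kindWLocalBall_eq_zero_of_invariant L e dV hdV dW hdW v.1 (νv v.1) (hπ v.1) (S : Matrix (Fin n) (Fin n) L) hk' hu₀ hψ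
    (G := fun y => FvT j S h v s (UnitaryGroup.evalPlace (Fp L) L (IsCMField.complexConj L) (n + n) (hermD L e dV hdV dW hdW) v.1
                (UnitaryGroup.finPart (Fp L) L (IsCMField.complexConj L) (n + n) (hermD L e dV hdV dW hdW) (weylDelta L e dV hdV dW hdW)) *
              ((y : ↥(unipDeltaLoc L e dV hdV dW hdW v.1)) : UnitaryGroup.localPi L (IsCMField.complexConj L) (n + n) (hermD L e dV hdV dW hdW) v.1) *
              UnitaryGroup.evalPlace (Fp L) L (IsCMField.complexConj L) (n + n) (hermD L e dV hdV dW hdW) v.1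
                (UnitaryGroup.finPart (Fp L) L (IsCMField.complexConj L) (n + n) (hermD L e dV hdV dW hdW) h))) hFinv).symm

/-- **`Ffin ≠ 0 ⟹ ψ_S ≡ 1` ON THE INVARIANCE BALL** (contrapositive of `kindWFfin_eq_zero_of_invariant`): if `kindWFfin … j S h v s ≠ 0` then `ψ_S(ι_v u₀) = 1` for every `u₀`
in the ball of exponent `a₀` under which the local factor is invariant — the Fourier index `S` is orthogonal to the invariance lattice, i.e. lies in its DUAL.
[cite: Shimura1997, §18.4 Prop. 18.14] [cite: KudlaRallis1994, §2] -/
theorem unipDeltaChar_eq_one_of_kindWFfin_ne_zero (T₀ : Finset (HeightOneSpectrum (𝓞 (Fp L))))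
    (νv : ∀ v : HeightOneSpectrum (𝓞 (Fp L)), Measure ↥(unipDeltaLoc L e dV hdV dW hdW v)) (hν : ∀ v, (νv v).IsMulLeftInvariant)
    {π : ∀ v : HeightOneSpectrum (𝓞 (Fp L)), v.adicCompletion (Fp L)} (hπ : ∀ v, Valued.v (π v) = WithZero.exp (-1 : ℤ)) {m : ℕ}
    (FvT : Fin m → ∀ (S : skewMatrices ((IsCMField.complexConj L : L ≃ₐ[Fp L] L) : L →+* L) ((gramR L e dV hdV dW hdW).map (algebraMap (Fp L) L)))
      (h : HA L e dV hdV dW hdW) (v : (kindWFinset L e dV hdV dW hdW T₀ (S : Matrix (Fin n) (Fin n) L) h)), ℂ → UnitaryGroup.localPi L (IsCMField.complexConj L) (n + n) (hermD L e dV hdV dW hdW) v.1 → ℂ)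
    (j : Fin m) (S : skewMatrices ((IsCMField.complexConj L : L ≃ₐ[Fp L] L) : L →+* L) ((gramR L e dV hdV dW hdW).map (algebraMap (Fp L) L)))
    (h : HA L e dV hdV dW hdW) (v : (kindWFinset L e dV hdV dW hdW T₀ (S : Matrix (Fin n) (Fin n) L) h)) (s : ℂ)
    (hne : kindWFfin L e dV hdV dW hdW T₀ νv π FvT j S h v.1 s ≠ 0)
    {a₀ : ℤ} {u₀ : ↥(unipDeltaLoc L e dV hdV dW hdW v.1)} (hu₀ : u₀ ∈ kindWLocalBall L e dV hdV dW hdW v.1 (π v.1) a₀)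
    (hFinv : ∀ y : ↥(unipDeltaLoc L e dV hdV dW hdW v.1),
      FvT j S h v s (UnitaryGroup.evalPlace (Fp L) L (IsCMField.complexConj L) (n + n) (hermD L e dV hdV dW hdW) v.1
                (UnitaryGroup.finPart (Fp L) L (IsCMField.complexConj L) (n + n) (hermD L e dV hdV dW hdW) (weylDelta L e dV hdV dW hdW)) *
              ((y * u₀ : ↥(unipDeltaLoc L e dV hdV dW hdW v.1)) : UnitaryGroup.localPi L (IsCMField.complexConj L) (n + n) (hermD L e dV hdV dW hdW) v.1) *
              UnitaryGroup.evalPlace (Fp L) L (IsCMField.complexConj L) (n + n) (hermD L e dV hdV dW hdW) v.1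
                (UnitaryGroup.finPart (Fp L) L (IsCMField.complexConj L) (n + n) (hermD L e dV hdV dW hdW) h)) =
      FvT j S h v s (UnitaryGroup.evalPlace (Fp L) L (IsCMField.complexConj L) (n + n) (hermD L e dV hdV dW hdW) v.1
                (UnitaryGroup.finPart (Fp L) L (IsCMField.complexConj L) (n + n) (hermD L e dV hdV dW hdW) (weylDelta L e dV hdV dW hdW)) *
              ((y : ↥(unipDeltaLoc L e dV hdV dW hdW v.1)) : UnitaryGroup.localPi L (IsCMField.complexConj L) (n + n) (hermD L e dV hdV dW hdW) v.1) *
              UnitaryGroup.evalPlace (Fp L) L (IsCMField.complexConj L) (n + n) (hermD L e dV hdV dW hdW) v.1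
                (UnitaryGroup.finPart (Fp L) L (IsCMField.complexConj L) (n + n) (hermD L e dV hdV dW hdW) h))) :
    unipDeltaChar L e dV hdV dW hdW (S : Matrix (Fin n) (Fin n) L) (locToAdelic L e dV hdV dW hdW v.1 (u₀ : UnitaryGroup.localPi L (IsCMField.complexConj L) (n + n) (hermD L e dV hdV dW hdW) v.1)) = 1 := by
  by_contra hψ
  exact hne (kindWFfin_eq_zero_of_invariant L e dV hdV dW hdW T₀ νv hν hπ FvT j S h v s hu₀ hψ hFinv)

/-! ## §5 The dealt letter: ★ p863047's `hsuppLoc` at `Ffin := kindWFfin`, from the LEVEL letter and the DUAL-LATTICE letter -/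

set_option maxHeartbeats 800000 in -- MEASURED: two dependent `FvT` letter blocks in the statement; 400 000 fails at `whnf`, 800 000 passes
/-- **THE PER-PLACE SUPPORT LETTER `hsuppLoc` OF ★ `K2LiuKindWFinitePartLettersOfRecord.hfsupp_of_levelLetters` AT `Ffin := kindWFfin`** (its binder bytes, with
`ι := Skew`, `X := H(𝔸)`, `κT := Fin m`, `mat S := ↑S`, `Tfin S h := kindWFinset T₀ ↑S h`, `Ffin v j S s h := kindWFfin T₀ νv π FvT j S h v s`), from two letters BY VALUE:
the LEVEL letter `hFinv` — on the ball of exponent `a₀ h v` of `N_Δ(L⁺_v)` the local factor at `h` is invariant, `FvT j S h v s (W_v·ι(y u₀)·h_v) = FvT j S h v s (W_v·ι(y)·h_v)`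
(payer: the reading of `FvT` + the uniform open level of the standard family ★ (ρ7) + level-vs-height ★ (c1)) — and the DUAL-LATTICE letter `hdual` — «`ψ_S(ι_v u₀) = 1` for all
`u₀` in that ball ⟹ `|S a b|_w ≤ q_w ^ (lev h w + c w)` at every `w ∣ v`» (payer: character duality, ★ (ρ3) `valued_entry_le_exp_of_forall_test` at `n = 2`).  MECHANISM =
§4: `Ffin ≠ 0 ⟹ ψ_S ≡ 1` on the invariance ball.  The hypothesis `0 < re s` of the bytes is carried, unused.
[cite: Shimura1997, §18.4 Prop. 18.14] [cite: KudlaRallis1994, §2] [cite: Casselman1980, §3] -/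
theorem hsuppLoc_of_level (T₀ : Finset (HeightOneSpectrum (𝓞 (Fp L))))
    (νv : ∀ v : HeightOneSpectrum (𝓞 (Fp L)), Measure ↥(unipDeltaLoc L e dV hdV dW hdW v)) (hν : ∀ v, (νv v).IsMulLeftInvariant)
    {π : ∀ v : HeightOneSpectrum (𝓞 (Fp L)), v.adicCompletion (Fp L)} (hπ : ∀ v, Valued.v (π v) = WithZero.exp (-1 : ℤ)) {m : ℕ}
    (FvT : Fin m → ∀ (S : skewMatrices ((IsCMField.complexConj L : L ≃ₐ[Fp L] L) : L →+* L) ((gramR L e dV hdV dW hdW).map (algebraMap (Fp L) L)))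
      (h : HA L e dV hdV dW hdW) (v : (kindWFinset L e dV hdV dW hdW T₀ (S : Matrix (Fin n) (Fin n) L) h)), ℂ → UnitaryGroup.localPi L (IsCMField.complexConj L) (n + n) (hermD L e dV hdV dW hdW) v.1 → ℂ)
    (lev : HA L e dV hdV dW hdW → HeightOneSpectrum (𝓞 L) → ℕ) (c : HeightOneSpectrum (𝓞 L) → ℕ)
    (a₀ : HA L e dV hdV dW hdW → HeightOneSpectrum (𝓞 (Fp L)) → ℤ)
    (hFinv : ∀ (j : Fin m) (S : skewMatrices ((IsCMField.complexConj L : L ≃ₐ[Fp L] L) : L →+* L) ((gramR L e dV hdV dW hdW).map (algebraMap (Fp L) L)))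
      (h : HA L e dV hdV dW hdW) (v : HeightOneSpectrum (𝓞 (Fp L))) (hv : v ∈ kindWFinset L e dV hdV dW hdW T₀ (S : Matrix (Fin n) (Fin n) L) h) (s : ℂ)
      (y u₀ : ↥(unipDeltaLoc L e dV hdV dW hdW v)), u₀ ∈ kindWLocalBall L e dV hdV dW hdW v (π v) (a₀ h v) →
      FvT j S h ⟨v, hv⟩ s (UnitaryGroup.evalPlace (Fp L) L (IsCMField.complexConj L) (n + n) (hermD L e dV hdV dW hdW) v
                (UnitaryGroup.finPart (Fp L) L (IsCMField.complexConj L) (n + n) (hermD L e dV hdV dW hdW) (weylDelta L e dV hdV dW hdW)) *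
              ((y * u₀ : ↥(unipDeltaLoc L e dV hdV dW hdW v)) : UnitaryGroup.localPi L (IsCMField.complexConj L) (n + n) (hermD L e dV hdV dW hdW) v) *
              UnitaryGroup.evalPlace (Fp L) L (IsCMField.complexConj L) (n + n) (hermD L e dV hdV dW hdW) v
                (UnitaryGroup.finPart (Fp L) L (IsCMField.complexConj L) (n + n) (hermD L e dV hdV dW hdW) h)) =
      FvT j S h ⟨v, hv⟩ s (UnitaryGroup.evalPlace (Fp L) L (IsCMField.complexConj L) (n + n) (hermD L e dV hdV dW hdW) v
                (UnitaryGroup.finPart (Fp L) L (IsCMField.complexConj L) (n + n) (hermD L e dV hdV dW hdW) (weylDelta L e dV hdV dW hdW)) *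
              ((y : ↥(unipDeltaLoc L e dV hdV dW hdW v)) : UnitaryGroup.localPi L (IsCMField.complexConj L) (n + n) (hermD L e dV hdV dW hdW) v) *
              UnitaryGroup.evalPlace (Fp L) L (IsCMField.complexConj L) (n + n) (hermD L e dV hdV dW hdW) v
                (UnitaryGroup.finPart (Fp L) L (IsCMField.complexConj L) (n + n) (hermD L e dV hdV dW hdW) h)))
    (hdual : ∀ (S : skewMatrices ((IsCMField.complexConj L : L ≃ₐ[Fp L] L) : L →+* L) ((gramR L e dV hdV dW hdW).map (algebraMap (Fp L) L)))
      (h : HA L e dV hdV dW hdW) (v : HeightOneSpectrum (𝓞 (Fp L))) (w : UnitaryGroup.PlacesOver L v) (a b : Fin n),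
      (∀ u₀ : ↥(unipDeltaLoc L e dV hdV dW hdW v), u₀ ∈ kindWLocalBall L e dV hdV dW hdW v (π v) (a₀ h v) →
        unipDeltaChar L e dV hdV dW hdW (S : Matrix (Fin n) (Fin n) L) (locToAdelic L e dV hdV dW hdW v (u₀ : UnitaryGroup.localPi L (IsCMField.complexConj L) (n + n) (hermD L e dV hdV dW hdW) v)) = 1) →
      Valued.v ((((S : Matrix (Fin n) (Fin n) L) a b : L)) : w.1.adicCompletion L) ≤ WithZero.exp (((lev h w.1 + c w.1 : ℕ) : ℤ))) :
    ∀ (v : HeightOneSpectrum (𝓞 (Fp L))) (j : Fin m) (S : skewMatrices ((IsCMField.complexConj L : L ≃ₐ[Fp L] L) : L →+* L) ((gramR L e dV hdV dW hdW).map (algebraMap (Fp L) L)))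
      (s : ℂ) (h : HA L e dV hdV dW hdW), v ∈ kindWFinset L e dV hdV dW hdW T₀ (S : Matrix (Fin n) (Fin n) L) h → 0 < s.re →
      kindWFfin L e dV hdV dW hdW T₀ νv π FvT j S h v s ≠ 0 →
      ∀ (w : UnitaryGroup.PlacesOver L v) (a b : Fin n),
        Valued.v ((((S : Matrix (Fin n) (Fin n) L) a b : L)) : w.1.adicCompletion L) ≤ WithZero.exp (((lev h w.1 + c w.1 : ℕ) : ℤ)) := by
  intro v j S s h hv _hs hne w a b
  exact hdual S h v w a b fun u₀ hu₀ =>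
    unipDeltaChar_eq_one_of_kindWFfin_ne_zero L e dV hdV dW hdW T₀ νv hν hπ FvT j S h ⟨v, hv⟩ s hne hu₀ fun y => hFinv j S h v hv s y u₀ hu₀

end Place

section Guarded -- §6 (ED. 2): the same letter at the GUARDED reading of record `Ffin j S h v s := if det S = 0 then 0 else kindWFfin … j S h v s`
variable [∀ v : HeightOneSpectrum (𝓞 (Fp L)), MeasurableSpace ↥(unipDeltaLoc L e dV hdV dW hdW v)]
  [∀ v : HeightOneSpectrum (𝓞 (Fp L)), BorelSpace ↥(unipDeltaLoc L e dV hdV dW hdW v)]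

set_option maxHeartbeats 800000 in -- MEASURED as §5 (two dependent `FvT` letter blocks in the statement): 400 000 fails at `whnf`, 800 000 passes
/-- **ED. 2 — `hsuppLoc` AT THE GUARDED READING OF RECORD.**  The KW head of record reads the finite letter as `Ffin j S h v s := if det ↑S = 0 then 0 else kindWFfin … j S h v s`
(📤 p863658 ED. 2 §3; K2E3-typ3 (g2) (KW-fin-probe) v4); this is §5 `hsuppLoc_of_level` with exactly that `Ffin` in the bytes, so the tie's slot `hsuppLoc` is met BY NAME
(`det ↑S = 0`: the premise `0 ≠ 0` is vacuous; else §5). [cite: Shimura1997, §18.4 Prop. 18.14] [cite: KudlaRallis1994, §2] -/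
theorem hsuppLoc_of_level_guarded (T₀ : Finset (HeightOneSpectrum (𝓞 (Fp L))))
    (νv : ∀ v : HeightOneSpectrum (𝓞 (Fp L)), Measure ↥(unipDeltaLoc L e dV hdV dW hdW v)) (hν : ∀ v, (νv v).IsMulLeftInvariant)
    {π : ∀ v : HeightOneSpectrum (𝓞 (Fp L)), v.adicCompletion (Fp L)} (hπ : ∀ v, Valued.v (π v) = WithZero.exp (-1 : ℤ)) {m : ℕ}
    (FvT : Fin m → ∀ (S : skewMatrices ((IsCMField.complexConj L : L ≃ₐ[Fp L] L) : L →+* L) ((gramR L e dV hdV dW hdW).map (algebraMap (Fp L) L)))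
      (h : HA L e dV hdV dW hdW) (v : (kindWFinset L e dV hdV dW hdW T₀ (S : Matrix (Fin n) (Fin n) L) h)), ℂ → UnitaryGroup.localPi L (IsCMField.complexConj L) (n + n) (hermD L e dV hdV dW hdW) v.1 → ℂ)
    (lev : HA L e dV hdV dW hdW → HeightOneSpectrum (𝓞 L) → ℕ) (c : HeightOneSpectrum (𝓞 L) → ℕ) (a₀ : HA L e dV hdV dW hdW → HeightOneSpectrum (𝓞 (Fp L)) → ℤ)
    (hFinv : ∀ (j : Fin m) (S : skewMatrices ((IsCMField.complexConj L : L ≃ₐ[Fp L] L) : L →+* L) ((gramR L e dV hdV dW hdW).map (algebraMap (Fp L) L)))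
      (h : HA L e dV hdV dW hdW) (v : HeightOneSpectrum (𝓞 (Fp L))) (hv : v ∈ kindWFinset L e dV hdV dW hdW T₀ (S : Matrix (Fin n) (Fin n) L) h) (s : ℂ)
      (y u₀ : ↥(unipDeltaLoc L e dV hdV dW hdW v)), u₀ ∈ kindWLocalBall L e dV hdV dW hdW v (π v) (a₀ h v) →
      FvT j S h ⟨v, hv⟩ s (UnitaryGroup.evalPlace (Fp L) L (IsCMField.complexConj L) (n + n) (hermD L e dV hdV dW hdW) v (UnitaryGroup.finPart (Fp L) L (IsCMField.complexConj L) (n + n) (hermD L e dV hdV dW hdW) (weylDelta L e dV hdV dW hdW)) *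
              ((y * u₀ : ↥(unipDeltaLoc L e dV hdV dW hdW v)) : UnitaryGroup.localPi L (IsCMField.complexConj L) (n + n) (hermD L e dV hdV dW hdW) v) * UnitaryGroup.evalPlace (Fp L) L (IsCMField.complexConj L) (n + n) (hermD L e dV hdV dW hdW) v (UnitaryGroup.finPart (Fp L) L (IsCMField.complexConj L) (n + n) (hermD L e dV hdV dW hdW) h)) =
      FvT j S h ⟨v, hv⟩ s (UnitaryGroup.evalPlace (Fp L) L (IsCMField.complexConj L) (n + n) (hermD L e dV hdV dW hdW) v (UnitaryGroup.finPart (Fp L) L (IsCMField.complexConj L) (n + n) (hermD L e dV hdV dW hdW) (weylDelta L e dV hdV dW hdW)) *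
              ((y : ↥(unipDeltaLoc L e dV hdV dW hdW v)) : UnitaryGroup.localPi L (IsCMField.complexConj L) (n + n) (hermD L e dV hdV dW hdW) v) * UnitaryGroup.evalPlace (Fp L) L (IsCMField.complexConj L) (n + n) (hermD L e dV hdV dW hdW) v (UnitaryGroup.finPart (Fp L) L (IsCMField.complexConj L) (n + n) (hermD L e dV hdV dW hdW) h)))
    (hdual : ∀ (S : skewMatrices ((IsCMField.complexConj L : L ≃ₐ[Fp L] L) : L →+* L) ((gramR L e dV hdV dW hdW).map (algebraMap (Fp L) L)))
      (h : HA L e dV hdV dW hdW) (v : HeightOneSpectrum (𝓞 (Fp L))) (w : UnitaryGroup.PlacesOver L v) (a b : Fin n),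
      (∀ u₀ : ↥(unipDeltaLoc L e dV hdV dW hdW v), u₀ ∈ kindWLocalBall L e dV hdV dW hdW v (π v) (a₀ h v) →
        unipDeltaChar L e dV hdV dW hdW (S : Matrix (Fin n) (Fin n) L) (locToAdelic L e dV hdV dW hdW v (u₀ : UnitaryGroup.localPi L (IsCMField.complexConj L) (n + n) (hermD L e dV hdV dW hdW) v)) = 1) →
      Valued.v ((((S : Matrix (Fin n) (Fin n) L) a b : L)) : w.1.adicCompletion L) ≤ WithZero.exp (((lev h w.1 + c w.1 : ℕ) : ℤ))) :
    ∀ (v : HeightOneSpectrum (𝓞 (Fp L))) (j : Fin m) (S : skewMatrices ((IsCMField.complexConj L : L ≃ₐ[Fp L] L) : L →+* L) ((gramR L e dV hdV dW hdW).map (algebraMap (Fp L) L)))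
      (s : ℂ) (h : HA L e dV hdV dW hdW), v ∈ kindWFinset L e dV hdV dW hdW T₀ (S : Matrix (Fin n) (Fin n) L) h → 0 < s.re →
      (if (S : Matrix (Fin n) (Fin n) L).det = 0 then (0 : ℂ) else kindWFfin L e dV hdV dW hdW T₀ νv π FvT j S h v s) ≠ 0 →
      ∀ (w : UnitaryGroup.PlacesOver L v) (a b : Fin n),
        Valued.v ((((S : Matrix (Fin n) (Fin n) L) a b : L)) : w.1.adicCompletion L) ≤ WithZero.exp (((lev h w.1 + c w.1 : ℕ) : ℤ)) := by
  intro v j S s h hv hs hne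
  by_cases hdet : (S : Matrix (Fin n) (Fin n) L).det = 0
  · rw [if_pos hdet] at hne; exact absurd rfl hne
  · rw [if_neg hdet] at hne
    exact hsuppLoc_of_level L e dV hdV dW hdW T₀ νv hν hπ FvT lev c a₀ hFinv hdual v j S s h hv hs hne

end Guarded
end Summit.HodgeConjecture.HodgeConjecture.Cruxes.HLiu418.K2LiuKindWFiniteSupportLetterOfLevel

end
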